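import Summits.Ventures.PercRepro.S1SeriesLeverExact
import Summits.Ventures.PercRepro.S1CellNineTenCaps
import Summits.Ventures.PercRepro.S1CellNineNineCaps
import Summits.Ventures.PercRepro.S1CellNineEightCaps

/-!
# PercRepro — THE ROW-9 CELLS ON THE REFINED LEVER: THE CAP HYPOTHESES REDUCED (p2, gen 26; SUBCLAIM-S1 §6.10)

`gbR` (S1SeriesLeverExact) reads `70 / 100 / 144` on the coloop-free `17 / 18 / 19`-point cores of nullity `8 / 9 / 10`
and `76 / 85` on the `16 / 15`-point cores of nullity `8`, so the first rows of the cap tables of S1CellNineEightCaps,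
S1CellNineNineCaps and S1CellNineTenCaps are theorems: `(9, 10)` needs its cap only at `t ≥ 17` (`144 ≤ 148` at
`t = 16`), `(9, 9)` only at `t ≥ 9` (`100 ≤ 103` at `t = 8`), `(9, 8)` only at `t ≥ 1` on `17` points (`70 = 70` at
`t = 0`) and `t ≥ 9` on `16` points (`76 ≤ 80` at `t = 8`), and not at all on `15` points (`85 ≤ 88`).

* **`c025_core_nine_ten_of_cap'`**, **`c025_core_nine_nine_of_cap'`**, **`c025_core_nine_eight_of_caps'`** — the
  cells with the reduced hypotheses.
Axioms: standard.
-/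

open scoped Matroid

namespace PercRepro

namespace S1

open Set

variable {α : Type}

/-- **THE CELL `(9, 10)` MODULO THE CAP AT `t ≥ 17` ONLY**: `gbR 10 19 = 144 ≤ 164 − 8 (t − 14)` for `t ≤ 16`. -/
theorem c025_core_nine_ten_of_cap' (M : Matroid α) [M.Finite] (hR : M.eRank = (9 : ℕ)) (hn : M.E.ncard = 19)
    (hfree : ∀ e ∈ M.E, ∃ A ⊆ M.E \ {e}, e ∉ M.closure A ∧ e ∉ M.closure ((M.E \ {e}) \ A))
    (hcap : ∀ (N : Matroid α) [N.Finite],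
      (∀ e ∈ N.E, ∃ A ⊆ N.E \ {e}, e ∉ N.closure A ∧ e ∉ N.closure ((N.E \ {e}) \ A)) →
      N.E.encard = N.eRank + ((10 : ℕ) : ℕ∞) → N.E.ncard = 19 → N.coloops = ∅ →
      ∀ t, 17 ≤ t → {C : Set α | N.IsCircuit C ∧ C.ncard = 3}.ncard = t →
      {C : Set α | N.IsCircuit C ∧ C.ncard = 4}.ncard ≤ 164 - 8 * (t - 14)) :
    ThmN.RLS M 9 4 := by
  refine c025_core_nine_ten_of_cap M hR hn hfree ?_
  intro N _ hNfree hNd hNn hNcol t ht14 hs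
  rcases Nat.lt_or_ge t 17 with h17 | h17
  · have hg := ncard_fourCircuits_le_gbR_of_coloopFree N hNfree hNd hNcol hNn
    have hv : gbR 10 19 = 144 := gbR_values.2.2.1
    rw [hv] at hg
    omega
  · exact hcap N hNfree hNd hNn hNcol t h17 hs

/-- **THE CELL `(9, 9)` MODULO THE CAP AT `t ≥ 9` ONLY**: `gbR 9 18 = 100 ≤ capNineNineT t` for `t ≤ 8`. -/
theorem c025_core_nine_nine_of_cap' (M : Matroid α) [M.Finite] (hR : M.eRank = (9 : ℕ)) (hn : M.E.ncard = 18)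
    (hfree : ∀ e ∈ M.E, ∃ A ⊆ M.E \ {e}, e ∉ M.closure A ∧ e ∉ M.closure ((M.E \ {e}) \ A))
    (hcap : ∀ (N : Matroid α) [N.Finite],
      (∀ e ∈ N.E, ∃ A ⊆ N.E \ {e}, e ∉ N.closure A ∧ e ∉ N.closure ((N.E \ {e}) \ A)) →
      N.E.encard = N.eRank + ((9 : ℕ) : ℕ∞) → N.E.ncard = 18 → N.coloops = ∅ →
      ∀ t, 9 ≤ t → {C : Set α | N.IsCircuit C ∧ C.ncard = 3}.ncard = t →
      {C : Set α | N.IsCircuit C ∧ C.ncard = 4}.ncard ≤ capNineNineT t) :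
    ThmN.RLS M 9 4 := by
  refine c025_core_nine_nine_of_cap M hR hn hfree ?_
  intro N _ hNfree hNd hNn hNcol t ht6 hs
  rcases Nat.lt_or_ge t 9 with h9 | h9
  · have hg := ncard_fourCircuits_le_gbR_of_coloopFree N hNfree hNd hNcol hNn
    have hv : gbR 9 18 = 100 := gbR_values.2.1
    rw [hv] at hg
    have hc : 100 ≤ capNineNineT t := by
      unfold capNineNineT
      interval_cases t <;> decide
    omega
  · exact hcap N hNfree hNd hNn hNcol t h9 hs

/-- **THE CELL `(9, 8)` MODULO TWO REDUCED TABLES**: on `17` points the cap is needed at `t ≥ 1` only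
(`gbR 8 17 = 70 = capNineEight17 0`), on `16` points at `t ≥ 9` only (`gbR 8 16 = 76 ≤ 81, 80`), and the `15`-point
cap is a theorem (`gbR 8 15 = 85 ≤ 88`). -/
theorem c025_core_nine_eight_of_caps' (M : Matroid α) [M.Finite] (hR : M.eRank = (9 : ℕ)) (hn : M.E.ncard = 17)
    (hfree : ∀ e ∈ M.E, ∃ A ⊆ M.E \ {e}, e ∉ M.closure A ∧ e ∉ M.closure ((M.E \ {e}) \ A))
    (hcap17 : ∀ (N : Matroid α) [N.Finite],
      (∀ e ∈ N.E, ∃ A ⊆ N.E \ {e}, e ∉ N.closure A ∧ e ∉ N.closure ((N.E \ {e}) \ A)) →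
      N.E.encard = N.eRank + ((8 : ℕ) : ℕ∞) → N.E.ncard = 17 → N.coloops = ∅ →
      ∀ t, 1 ≤ t → {C : Set α | N.IsCircuit C ∧ C.ncard = 3}.ncard = t →
      {C : Set α | N.IsCircuit C ∧ C.ncard = 4}.ncard ≤ capNineEight17 t)
    (hcap16 : ∀ (N : Matroid α) [N.Finite],
      (∀ e ∈ N.E, ∃ A ⊆ N.E \ {e}, e ∉ N.closure A ∧ e ∉ N.closure ((N.E \ {e}) \ A)) →
      N.E.encard = N.eRank + ((8 : ℕ) : ℕ∞) → N.E.ncard = 16 → N.coloops = ∅ →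
      ∀ t, 9 ≤ t → {C : Set α | N.IsCircuit C ∧ C.ncard = 3}.ncard = t →
      {C : Set α | N.IsCircuit C ∧ C.ncard = 4}.ncard ≤ capNineEight16 t) :
    ThmN.RLS M 9 4 := by
  refine c025_core_nine_eight_of_caps M hR hn hfree ?_ ?_ ?_
  · intro N _ hNfree hNd hNn hNcol t hs
    rcases Nat.eq_zero_or_pos t with h0 | hpos
    · have hg := ncard_fourCircuits_le_gbR_of_coloopFree N hNfree hNd hNcol hNn
      have hv : gbR 8 17 = 70 := gbR_values.1
      rw [hv] at hg
      rw [h0]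
      exact hg
    · exact hcap17 N hNfree hNd hNn hNcol t hpos hs
  · intro N _ hNfree hNd hNn hNcol t ht7 hs
    rcases Nat.lt_or_ge t 9 with h9 | h9
    · have hg := ncard_fourCircuits_le_gbR_of_coloopFree N hNfree hNd hNcol hNn
      have hv : gbR 8 16 = 76 := gbR_values.2.2.2.1
      rw [hv] at hg
      have hc : 76 ≤ capNineEight16 t := by
        unfold capNineEight16
        interval_cases t <;> decide
      omega
    · exact hcap16 N hNfree hNd hNn hNcol t h9 hs
  · intro N _ hNfree hNd hNn hNcol _
    have hg := ncard_fourCircuits_le_gbR_of_coloopFree N hNfree hNd hNcol hNn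
    have hv : gbR 8 15 = 85 := gbR_values.2.2.2.2
    rw [hv] at hg
    omega

end S1

end PercRepro
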